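import Summits.AtomisticToContinuum.HydrodynamicLimit.Theorems.InformationPercolationEnginePercolationClosesChaosForecastDefs
import Literature.MathematicalPhysics.KineticTheory.MollifiedPoolPairField
import HarnessLib

/-!
# Vocabulary of the line `equilibrium-forecast-chain-rule` for the crux `InformationPercolationEngine.PercolationClosesChaos`
(stmt-AtomisticToContinuum-15178) — part 2: the typed statements

Definitions-only support file (`--supports stmt-AtomisticToContinuum-15178`), companion of `…ForecastDefs.lean` (the objects):
the skeleton's §5, byte-for-byte, in namespace `…Theorems.EquilibriumForecastLine` — the seven `def … : Prop` statements the
registered stubs prove or consume (`MesoConditionalEquidistribution` v2 = S2 in large-deviation form, crux-class;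
`KineticCellChaosLG` = output of the transfer S6; `LocalCountUI` = S3, `NoMesoscopicOscillation` = S4,
`RevealedDefectStability` = S8, item-class LG-side inputs; `CoarseLocalMaxwellianity` = output of S5; `NoMesoscopicOscillation` is
typed against `targetPm` of the Defs file = the target's `bt`-mollified `r`-ball pair field copied from `ContactChaos`'s `let`-block, so
that the docking S7 meets the target's own reference, Disproof F18(e) / `docking_reference_gap`). Nothing is asserted: each is a predicate, never a hypothesis taken as a fact; the
registered stub signatures (`stub_docking : KineticCellChaosLG → NoMesoscopicOscillation → LocalCountUI → ContactChaos`, …) are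
implications between them and the route target. Docstrings carry each statement's informal content, why it might fail, and its
audit history (lead a2 cycle 1: kill record of S2 v1, wave-1 audits).
-/

noncomputable section

open MeasureTheory Set Filter Topology
open scoped ENNReal BigOperators Classical
open Literature.Analysis.FluidPDE Literature.MathematicalPhysics.KineticTheory
open Literature.MathematicalPhysics.KineticTheory.VelocityBlindPlacement

namespace Summit.AtomisticToContinuum.HydrodynamicLimit.Theorems.EquilibriumForecastLine

/-! ## §5 The typed statements of the line -/

/-- **`MesoConditionalEquidistribution`** — v2, LARGE-DEVIATION FORM (lead a2, cycle 1). The v1 statement demanded (a)/(b) below for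
EVERY history atom of positive `G_N`-mass — an essential supremum over coarse histories of the one-step conditional forecast — and is
FALSE as typed (kill record `Lines/equilibrium-forecast-chain-rule-stub_mce-kill.md`): (b) on the `k = 0` "density-dip" snapshot atom
(`Regular` has no density floor; free streaming in a free-molecular pocket raises the smoothed relative entropy of a Regular cell by
`0.26–0.41` nats in one step; independently: void/inbound-beam atoms, wave-1 S5 audit), (a) on "Newton's-cradle" atoms (ordered record
lists without times pin the phase of an ongoing axis-aligned contact cascade — lab-frame mark `Ψ = min(ω₁², 1)` reads `≈ 1` on the
cascade's contacts against the flux reference `1/3`; `GoodUnit` sees no sub-cell geometry; the collision weighting saturates). Every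
such atom has `G_N`-mass `e^{−Θ(n̄)}` or less, INDEPENDENT OF `N` (local events), so no atomwise repair exists; what the transfer can
use instead — through the entropy inequality `LG(A) ≤ (K(N+1) + log 2)/log(1/G_N(A))` — is an LD bound on the space-time DENSITY of
units whose `G_N`-forecast is bad. Hence v2: there are an absolute packing threshold `φs > 0` and `σ₁ > 0` such that for every
`0 < σ ≤ σ₁`, every flow family and horizon `τ > 0`:
(a) FORECAST CHAOS OF GOOD UNITS, EXCEPT ON AN LD-RARE DENSITY OF UNITS — for every bounded continuous `Ψ` and `ϑs, η, δ, T, δ', L > 0`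
there are `ϑ > 0` and `c₀` such that for all `c ≥ c₀`, all bin widths `b > 0` and all large `N`:
`G_N{ z | the unit-fraction of (k, q) with (k,q) GOOD at kΔ and E_{G_N}[badWeight Ψ η T (k,q) | σ(seqHist b c σ N Φ k q)](z) > δ
exceeds δ' } ≤ e^{−L(N+1)}` (Mathlib `condExp` given the comap σ-algebra of the start-cell sequential history; its atoms are measurable,
wave-1 S6 audit `measurableSet_seqHist_eq`);
(b) CONDITIONAL COARSE H-THEOREM, SAME FORM — for `ϑs, ϑ, R, δ', L > 0` there are `κ > 0`, `ϑh > 0` such that for every slack `s > 0`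
there is `c₀` with: for `c ≥ c₀`, `b > 0`, large `N`:
`G_N{ z | unit-fraction of (k,q) REGULAR at kΔ with E_{G_N}[min(relEntAt((k+1)Δ) q, R) − min(relEntAt(kΔ) q, R) + κ𝟙{ϑ ≤ relEntAt(kΔ) q}
| σ(seqHistEnd b c σ N Φ k q)](z) > s exceeds δ' } ≤ e^{−L(N+1)}` — conditioned on the END-cell sequential past (wave-1 S5 audit: the
Eulerian increment is adapted to end-cell revelation; per-step conditioning would leave S5 a predictable-projection remainder
`R√(2K(N+1)K_N) ≫ K_N`).
How S5/S6 consume it: predictable projection (S1) in the sequential filtration turns `E_LG Σ X` into `E_LG Σ E_G[X | 𝓕]` up to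
`o(K_N)`; on good units `E_G[X|𝓕] ≤ δ·w + T·w·𝟙{forecast bad}`; the LG-expected fraction of forecast-bad units is `≤ δ' + (K + o(1))/L`
by the entropy inequality applied to the event in (a). The density-dip, void, cradle and converging-free-flight atoms of the kill
record are members of the exceptional density (`G_N`-probability `e^{−Θ(n̄)}` per unit, `→ 0` as `c → ∞`, which is what `∃ c₀` is
for; concentration of the space-time fraction at speed `≫ N` is the LD content). Mechanism offered and status: a QUANTITATIVE
GROWTH LEMMA WITH EXCEPTIONAL SET for the dilute hard-sphere flow (expansion `ℓ/ε = (πσ³)⁻¹` per collision, `N`-independent local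
complexity; doi:10.1090/surv/127 Ch. 5/7, doi:10.1007/s00023-008-0389-1 Rem. 1.4, ChernovDolgopyat2009) PLUS an influence-locality /
block-decoupling LD bound for the density of history-defined local events under the invariant law (Lines/Sketch-dead.md §2(c)
arithmetic at a fixed threshold). Crux-class and OPEN (no `N`-uniform growth lemma for `N ≥ 3` balls is in print:
doi:10.1007/s00023-002-8624-7, doi:10.1088/0951-7715/25/5/1275); this is the stub the lead hands back as `promote-stub`. Why it might
STILL fail: a family of forecast-bad local patterns of `G_N`-density NOT vanishing as `c → ∞`; LD speed only `≍ N` (inside the budget)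
for some pattern because of long-range dynamical coherence. -/
def MesoConditionalEquidistribution : Prop :=
  ∃ φs : ℝ, 0 < φs ∧ ∃ σ₁ : ℝ, 0 < σ₁ ∧ ∀ σ : ℝ, 0 < σ → σ ≤ σ₁ → ∀ Φ : (N : ℕ) → Flow σ N, ∀ τ : ℝ, 0 < τ →
  (∀ Ψ : V3 × V3 × V3 → ℝ, Continuous Ψ → (∃ C : ℝ, ∀ p, |Ψ p| ≤ C) →
    ∀ ϑs η δ T δ' L : ℝ, 0 < ϑs → 0 < η → 0 < δ → 0 < T → 0 < δ' → 0 < L →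
    ∃ ϑ : ℝ, 0 < ϑ ∧ ∃ c₀ : ℝ, 0 < c₀ ∧ ∀ c : ℝ, c₀ ≤ c → ∀ b : ℝ, 0 < b →
    ∃ N₀ : ℕ, ∀ N : ℕ, N₀ ≤ N →
      eqLaw σ N (Φ N) {z | δ' < unitAvg c σ N τ fun k q =>
        if GoodUnit ϑs ϑ φs c σ N ((Φ N).flow ((k : ℝ) * stepLen c σ N) z) q ∧
            δ < MeasureTheory.condExp (MeasurableSpace.comap (seqHist b c σ N (Φ N) k q) ⊤) (eqLaw σ N (Φ N))
              (badWeight Ψ η T c σ N (Φ N) k q) z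
        then 1 else 0} ≤ ENNReal.ofReal (Real.exp (-(L * ((N : ℝ) + 1))))) ∧
  (∀ ϑs ϑ R δ' L : ℝ, 0 < ϑs → 0 < ϑ → 0 < R → 0 < δ' → 0 < L →
    ∃ κ : ℝ, 0 < κ ∧ ∃ ϑh : ℝ, 0 < ϑh ∧ ∀ s : ℝ, 0 < s → ∃ c₀ : ℝ, 0 < c₀ ∧ ∀ c : ℝ, c₀ ≤ c → ∀ b : ℝ, 0 < b →
    ∃ N₀ : ℕ, ∀ N : ℕ, N₀ ≤ N →
      eqLaw σ N (Φ N) {z | δ' < unitAvg c σ N τ fun k q =>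
        if Regular ϑs ϑh φs c σ N ((Φ N).flow ((k : ℝ) * stepLen c σ N) z) q ∧
            s < MeasureTheory.condExp (MeasurableSpace.comap (seqHistEnd b c σ N (Φ N) k q) ⊤) (eqLaw σ N (Φ N))
              (fun z => min (relEntAt ϑs c σ N (Φ N) (((k : ℝ) + 1) * stepLen c σ N) q z) R
                - min (relEntAt ϑs c σ N (Φ N) ((k : ℝ) * stepLen c σ N) q z) R
                + (if ϑ ≤ relEntAt ϑs c σ N (Φ N) ((k : ℝ) * stepLen c σ N) q z then κ else 0)) z
        then 1 else 0} ≤ ENNReal.ofReal (Real.exp (-(L * ((N : ℝ) + 1)))))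

/-- **`KineticCellChaosLG`** — KINETIC-CELL CHAOS UNDER LOCAL GIBBS DATA (the output of the transfer): for continuous positive
profiles there is `σ₀ > 0` such that for `0 < σ < σ₀`, every flow family, horizon `τ > 0`, bounded continuous `Ψ` and
`η, δ, T > 0` there is `c₀` with: for every `c ≥ c₀` and all large `N`, the `localGibbsLaw`-expectation of the unit average of
`badWeight Ψ η T` — the truncated collision-weighted fraction of owned (step, cell) units whose marks fail the cross-ratio test
by more than `η` — is at most `δ`. -/
def KineticCellChaosLG : Prop :=
  ∀ (a₀ θ₀ : T3 → ℝ) (u₀ : T3 → V3), Continuous a₀ → Continuous θ₀ → Continuous u₀ →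
    (∀ x, 0 < a₀ x) → (∀ x, 0 < θ₀ x) →
  ∃ σ₀ : ℝ, 0 < σ₀ ∧ ∀ σ : ℝ, 0 < σ → σ < σ₀ → ∀ Φ : (N : ℕ) → Flow σ N, ∀ τ : ℝ, 0 < τ →
  ∀ Ψ : V3 × V3 × V3 → ℝ, Continuous Ψ → (∃ C : ℝ, ∀ p, |Ψ p| ≤ C) →
  ∀ η δ T : ℝ, 0 < η → 0 < δ → 0 < T →
  ∃ c₀ : ℝ, 0 < c₀ ∧ ∀ c : ℝ, c₀ ≤ c → ∃ N₀ : ℕ, ∀ N : ℕ, N₀ ≤ N →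
    ∫⁻ z, ENNReal.ofReal (unitAvg c σ N τ fun k q => badWeight Ψ η T c σ N (Φ N) k q z)
      ∂(localGibbsLaw σ a₀ u₀ θ₀ N (Φ N)) ≤ ENNReal.ofReal δ

/-- **`LocalCountUI`** — LOCAL UNIFORM INTEGRABILITY OF KINETIC COLLISION COUNTS AND A PACKING CAP UNDER THE EVOLVED LAW (the
tail input; Disproof F18 d(ii): MORE than tightness of the total `K_N[1]`, hence more than `CollisionMomentBound` 15144, whose
count part it refines): for every packing threshold `φs > 0` and continuous positive profiles there is `σ₀ > 0` (depending on
`φs`: typical packing `ρ (π/6) σ³ ≪ φs`) such that for `0 < σ < σ₀`, every flow family, `τ > 0` and `δ > 0`: (i) there is a level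
`T` such that for every kinetic scale `c ≥ 1` and all large `N` the unit average of `rowCount · 𝟙{rowCount > T}` has
`LG`-expectation `≤ δ` (uniformly in `c ≥ 1`: coarser units only average more; v2: ROW counts per start cell instead of lex-min owned
counts — wave-1 S7 audit R2a, the per-particle count control the docking needs; `ownedCount` is dominated by the two members' rows); (ii) there is `c₀` such that for `c ≥ c₀` and all
large `N` the unit-fraction of occupied cells with a `φs`-PACKED `4cℓ`-neighbourhood at the step start has `LG`-expectation `≤ δ`
(`c` large kills the `e^{−I n̄(c)}` fluctuation floor). Why it might fail: only with a macroscopic fraction of collisions in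
over-colliding kinetic neighbourhoods, or packing `≥ φs` on a non-vanishing fraction of cells, at positive times (caged rattlers,
implosion pockets — DensityCap 13082 / F10 e class: after an implosion the macroscopic density is unbounded in the Euler model);
the `G_N`-side super-extensive pricing of counts (F20/F21) makes (i) entropy-transferable in principle. -/
def LocalCountUI : Prop :=
  ∀ φs : ℝ, 0 < φs →
  ∀ (a₀ θ₀ : T3 → ℝ) (u₀ : T3 → V3), Continuous a₀ → Continuous θ₀ → Continuous u₀ →
    (∀ x, 0 < a₀ x) → (∀ x, 0 < θ₀ x) →
  ∃ σ₀ : ℝ, 0 < σ₀ ∧ ∀ σ : ℝ, 0 < σ → σ < σ₀ → ∀ Φ : (N : ℕ) → Flow σ N, ∀ τ : ℝ, 0 < τ → ∀ δ : ℝ, 0 < δ →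
    (∃ T : ℝ, 0 < T ∧ ∀ c : ℝ, 1 ≤ c → ∃ N₀ : ℕ, ∀ N : ℕ, N₀ ≤ N →
      ∫⁻ z, ENNReal.ofReal (unitAvg c σ N τ fun k q =>
          rowCount c σ N (Φ N) k q z * (if T < rowCount c σ N (Φ N) k q z then 1 else 0))
        ∂(localGibbsLaw σ a₀ u₀ θ₀ N (Φ N)) ≤ ENNReal.ofReal δ) ∧
    (∃ c₀ : ℝ, 0 < c₀ ∧ ∀ c : ℝ, c₀ ≤ c → ∃ N₀ : ℕ, ∀ N : ℕ, N₀ ≤ N →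
      ∫⁻ z, ENNReal.ofReal (unitAvg c σ N τ fun k q =>
          if (pop c σ N ((Φ N).flow ((k : ℝ) * stepLen c σ N) z) q).Nonempty ∧
              Dense φs c σ N ((Φ N).flow ((k : ℝ) * stepLen c σ N) z) q then 1 else 0)
        ∂(localGibbsLaw σ a₀ u₀ θ₀ N (Φ N)) ≤ ENNReal.ofReal δ)

/-- **The docking reference is the target's, literally**: the line's `targetPm` (copied from `ContactChaos`'s `let`-block) is the
Literature `poolPairField` of the orbit (`bump = coneKernel`, `fluxAvg = sphereMark`, inner double integral = `pairFunctional`,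
all by `rfl`), so its sup / joint-Lipschitz / continuity bounds (`abs_poolPairField_le`, `abs_poolPairField_sub_le`,
`continuous_poolPairField`) are available to the docking S7 and to S4 (i) (wave-1 S7 audit v2). -/
theorem targetPm_eq_poolPairField : ∀ {σ : ℝ} {N : ℕ} (Ξ : V3 × V3 × V3 → ℝ) (r τ : ℝ) (Φ : Flow σ N) (z : Phase N) (s₀ : ℝ) (x₀ : T3), targetPm Ξ r τ σ N Φ z s₀ x₀ = poolPairField Φ Ξ τ r z (s₀, x₀) :=
  fun _ _ _ _ _ _ _ => rfl

/-- **`NoMesoscopicOscillation`** — NO STRUCTURE OF THE EVOLVED ONE-BODY LAW BETWEEN THE KINETIC CELL AND THE `r`-BALL (the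
shared residual of every line on this crux, here restricted to scales `[cℓ_N, r]` and typed against the target's own reference):
for continuous positive profiles there is `σ₀ > 0` such that for `0 < σ < σ₀`, every flow family and `τ > 0`:
(i) for every bounded continuous `Ξ` and `η, δ > 0` there is `r₀ > 0` such that for `0 < r < r₀` there is `c₀` with: for `c ≥ c₀`
and all large `N` (v2: `r₀` BEFORE `c₀`, wave-1 S7 audit §5 — every docking error term carries `sup A_r ≲ r⁻⁶√(2E₀)`, so the kinetic
statements are invoked at `r`-dependent `(η', δ', T)` whose `c₀` must not feed back into `r₀`), with `LG`-probability `≥ 1 − δ` the unit average over `(k, q)` of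
`Σ_{q'} collPair 1 (q,q') · |A_r(kΔ, centre q) · (pairPair Ξ / pairPair 1)(q,q') − B^Ξ_r(kΔ, centre q)|` is `≤ η`
(`A_r = targetPm 1`, `B^Ξ_r = targetPm Ξ`) — collision-weighted, the flux-weighted `Ξ`-average of each colliding kinetic cell
pair equals the `bt`-mollified `r`-ball one of the target at the same space-time point, in the target's unnormalised currency; (ii) for `ϑs, ϑ, δ > 0` there is `c₀` such that for `c ≥ c₀` and large `N` the unit-fraction of
`ϑ`-INHOMOGENEOUS cells with a nonempty `4cℓ`-neighbourhood has `LG`-expectation `≤ δ` (v2: EMPTY cells with a populated neighbourhood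
count — `kde ∅ = 0`, `inhom = 1` — i.e. "no kinetic voids" is folded in; wave-1 S5 audit: such cells are irregular, carry forecast drift up
to `+R(cℓ)³`, and v1 bounded their frequency nowhere). Mixture of products versus product of mixtures: it fails for a
two-stream pattern at scales `cℓ_N ≪ s ≪ r` and for rough (turbulent) limit fields (Disproof F10 b); not payable by the entropy
budget (`G_N`-cost only `e^{−cNa²}`) — the route's kill criterion (iv), filed openly (TRIAGE-r1-1/2/3, r2-1 sharpen 3). -/
def NoMesoscopicOscillation : Prop :=
  ∀ (a₀ θ₀ : T3 → ℝ) (u₀ : T3 → V3), Continuous a₀ → Continuous θ₀ → Continuous u₀ →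
    (∀ x, 0 < a₀ x) → (∀ x, 0 < θ₀ x) →
  ∃ σ₀ : ℝ, 0 < σ₀ ∧ ∀ σ : ℝ, 0 < σ → σ < σ₀ → ∀ Φ : (N : ℕ) → Flow σ N, ∀ τ : ℝ, 0 < τ →
  (∀ Ξ : V3 × V3 × V3 → ℝ, Continuous Ξ → (∃ C : ℝ, ∀ p, |Ξ p| ≤ C) →
    ∀ η δ : ℝ, 0 < η → 0 < δ → ∃ r₀ : ℝ, 0 < r₀ ∧ ∀ r : ℝ, 0 < r → r < r₀ →
    ∃ c₀ : ℝ, 0 < c₀ ∧ ∀ c : ℝ, c₀ ≤ c → ∃ N₀ : ℕ, ∀ N : ℕ, N₀ ≤ N →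
      localGibbsLaw σ a₀ u₀ θ₀ N (Φ N) {z | η < unitAvg c σ N τ fun k q => ∑' q' : Cell,
        collPair (fun _ => 1) c σ N (Φ N) k q q' z *
          |targetPm (fun _ => 1) r τ σ N (Φ N) z ((k : ℝ) * stepLen c σ N) (cellCentre c σ N q) *
              (pairPair Ξ c σ N (Φ N) k q q' z / pairPair (fun _ => 1) c σ N (Φ N) k q q' z) -
            targetPm Ξ r τ σ N (Φ N) z ((k : ℝ) * stepLen c σ N) (cellCentre c σ N q)|} ≤ ENNReal.ofReal δ) ∧
  (∀ ϑs ϑ δ : ℝ, 0 < ϑs → 0 < ϑ → 0 < δ → ∃ c₀ : ℝ, 0 < c₀ ∧ ∀ c : ℝ, c₀ ≤ c → ∃ N₀ : ℕ, ∀ N : ℕ, N₀ ≤ N →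
    ∫⁻ z, ENNReal.ofReal (unitAvg c σ N τ fun k q =>
        if (nbhd c σ N ((Φ N).flow ((k : ℝ) * stepLen c σ N) z) q).Nonempty ∧
            ϑ < inhom ϑs ((Φ N).flow ((k : ℝ) * stepLen c σ N) z)
              (pop c σ N ((Φ N).flow ((k : ℝ) * stepLen c σ N) z) q)
              (nbhd c σ N ((Φ N).flow ((k : ℝ) * stepLen c σ N) z) q) then 1 else 0)
      ∂(localGibbsLaw σ a₀ u₀ θ₀ N (Φ N)) ≤ ENNReal.ofReal δ)

/-- **`CoarseLocalMaxwellianity`** — LOCAL EQUILIBRIUM OF THE EVOLVED LAW AT THE KINETIC-CELL SCALE, IN THE MEAN (derived inside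
the line by `stub_cesaroLocalEquilibrium`, not assumed): for continuous positive profiles there is `σ₀ > 0` such that for
`0 < σ < σ₀`, every flow family, `τ > 0` and `ϑs, ϑ, δ > 0` there is `c₀` with: for `c ≥ c₀` and all large `N` the
unit-fraction of occupied cells whose population is `ϑ`-NON-MAXWELLIAN (smoothed relative entropy `> ϑ` at resolution `ϑs`)
has `LG`-expectation `≤ δ`. -/
def CoarseLocalMaxwellianity : Prop :=
  ∀ (a₀ θ₀ : T3 → ℝ) (u₀ : T3 → V3), Continuous a₀ → Continuous θ₀ → Continuous u₀ →
    (∀ x, 0 < a₀ x) → (∀ x, 0 < θ₀ x) →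
  ∃ σ₀ : ℝ, 0 < σ₀ ∧ ∀ σ : ℝ, 0 < σ → σ < σ₀ → ∀ Φ : (N : ℕ) → Flow σ N, ∀ τ : ℝ, 0 < τ →
  ∀ ϑs ϑ δ : ℝ, 0 < ϑs → 0 < ϑ → 0 < δ → ∃ c₀ : ℝ, 0 < c₀ ∧ ∀ c : ℝ, c₀ ≤ c → ∃ N₀ : ℕ, ∀ N : ℕ, N₀ ≤ N →
    ∫⁻ z, ENNReal.ofReal (unitAvg c σ N τ fun k q =>
        if (pop c σ N ((Φ N).flow ((k : ℝ) * stepLen c σ N) z) q).Nonempty ∧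
            ϑ < relEntAt ϑs c σ N (Φ N) ((k : ℝ) * stepLen c σ N) q z then 1 else 0)
      ∂(localGibbsLaw σ a₀ u₀ θ₀ N (Φ N)) ≤ ENNReal.ofReal δ

/-- **`RevealedDefectStability`** (v2; the sixth antecedent of the forecast transfer, wave-1 S6 audit §a3, typed in its rc-0 shadow file):
for continuous positive profiles there is `σ₀ > 0` such that for `0 < σ < σ₀`, every flow family, `τ > 0`, bounded continuous `Ψ` and
`η, δ, T > 0` there is `c₀` with: for every `c ≥ c₀` there is `b₀ > 0` such that for every bin width `0 < b ≤ b₀` and all large `N`,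
the `localGibbsLaw`-expectation of the unit average of `min(ownedCount, T) · 𝟙{η < defectOsc}` is at most `δ`. Content: under the
EVOLVED law the truncated unit-weight of units with an `η`-share of grazing (`|(v−w)·ω|` below the bin width, impact direction not
revealed by `jumps`) or fast-participant owned collisions, or with a fast-polluted / cold partner population, is small —
collision-measure uniform integrability of the `CollisionMomentBound` class plus a no-grazing-concentration bound; NOT implied by
`LocalCountUI`, `NoMesoscopicOscillation`, `CoarseLocalMaxwellianity`. Item-class (LG-side tail input, S3-adjacent). -/
def RevealedDefectStability : Prop :=
  ∀ (a₀ θ₀ : T3 → ℝ) (u₀ : T3 → V3), Continuous a₀ → Continuous θ₀ → Continuous u₀ →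
    (∀ x, 0 < a₀ x) → (∀ x, 0 < θ₀ x) →
  ∃ σ₀ : ℝ, 0 < σ₀ ∧ ∀ σ : ℝ, 0 < σ → σ < σ₀ → ∀ Φ : (N : ℕ) → Flow σ N, ∀ τ : ℝ, 0 < τ →
  ∀ Ψ : V3 × V3 × V3 → ℝ, Continuous Ψ → (∃ C : ℝ, ∀ p, |Ψ p| ≤ C) →
  ∀ η δ T : ℝ, 0 < η → 0 < δ → 0 < T →
  ∃ c₀ : ℝ, 0 < c₀ ∧ ∀ c : ℝ, c₀ ≤ c → ∃ b₀ : ℝ, 0 < b₀ ∧ ∀ b : ℝ, 0 < b → b ≤ b₀ → ∃ N₀ : ℕ, ∀ N : ℕ, N₀ ≤ N →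
    ∫⁻ z, ENNReal.ofReal (unitAvg c σ N τ fun k q =>
        min (ownedCount c σ N (Φ N) k q z) T *
          (if η < defectOsc Ψ b c σ N (Φ N) k q z then 1 else 0))
      ∂(localGibbsLaw σ a₀ u₀ θ₀ N (Φ N)) ≤ ENNReal.ofReal δ

end Summit.AtomisticToContinuum.HydrodynamicLimit.Theorems.EquilibriumForecastLine

end
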